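import Summits.HubbardSuperconductivity.HubbardSuperconductivity.Theorems.KacWindowPenaltyWindowGapTwistPricing
import Summits.HubbardSuperconductivity.HubbardSuperconductivity.Theorems.WindowGap.Negative.TwistCeilingWeights
import Summits.HubbardSuperconductivity.HubbardSuperconductivity.Theorems.KacWindowPenaltyWindowGapNormalForms
import Mathlib.Analysis.SpecialFunctions.Trigonometric.Bounds

/-!
# Crux `WindowGap` (stmt-HubbardSuperconductivity-1088): the twist ceiling, II —
# the Kac-window excess is `O((λε)^{2/3})` per site, so `(λ, a)` cannot be chosen before `ε`

Last step of the TWIST CEILING of `Cruxes/WindowGap/NOTES.md` §3/§8. For `H = hubbardTorus 2 L 1 U`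
(`L ≥ 3`), a form factor with `|f| ≤ 1`, the Kac-window pair penalty
`W_ε = L⁻² Σ_{|q_m| ≤ ε} Δ_f(m)ᴴ Δ_f(m)`, `λ, ε ≥ 0`, `4J < L` and any sector `K = szSector N M`
containing a unit vector attaining `minEnergyOn H K`:
`minEnergyOn (H + λW_ε) K − minEnergyOn H K ≤ 8π² J² + 50 λ (2⌊εL/2π⌋ + 1) L² / (2J + 1)`
(`windowGap_twistCeiling`): average the `2J + 1` twist pricings
(`twistPricing_minEnergyOn_add_smul_sub`); kinetic cost `≤ 2(1 − cos(2πj/L))|K₁| ≤ 8π²j²`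
(`abs_kineticWeight_le`, sine terms cancel, `sum_Icc_sin_eq_zero`); twisted window weights total
`≤ 50(2⌊εL/2π⌋ + 1)L²` (`sum_twistedWindowWeight_le`, part I).
Consequence (`not_windowGap_uniform`): the strengthening of the crux in which `λ > 0` and `a > 0`
are fixed BEFORE `∀ ε₀ ∃ ε ≤ ε₀` is FALSE at every `(U, δ)` (`J = ⌊γL⌋`, `γ = min (1/8) (√(λa)/8π)`,
`ε ≤ πγa/200` give `≤ (1/8 + 1/2)λaL²`); optimising, `gap/L² ≲ 32(λε)^{2/3}`: the window excess
density vanishes as the window shrinks at fixed coupling — the windowed form of the barrier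
`LROForcesLowLyingStates` (physically the witnesses must scale like `λ ≍ ρ_s ε²/m²`).
Support / negative for the crux (`--supports stmt-HubbardSuperconductivity-1088`); no definitions.
H. Watanabe, J. Stat. Phys. 177 (2019) 717, §2.2.1; E. Lieb, T. Schultz, D. Mattis, Ann. Phys. 16
(1961) 407; H. Tasaki (2020) §2.1.
-/

-- the mandated namespace repeats `HubbardSuperconductivity` (single-problem summit, D-0017)
set_option linter.dupNamespace false

noncomputable section
namespace Summit.HubbardSuperconductivity.HubbardSuperconductivity.Theorems.WindowGap.Negative

open Matrix Finset Literature.MathematicalPhysics.QuantumLattice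
  Literature.MathematicalPhysics.QuantumFieldTheory Literature.Probability.LatticeModels
  Summit.HubbardSuperconductivity.HubbardSuperconductivity.Theorems
open scoped ComplexConjugate

variable {L : ℕ} [NeZero L]

/-! ### The kinetic cost of the twists -/
/-- **The `e₁`-kinetic weight is at most `2L²` in absolute value**: for a unit Fock vector `ψ`,
`|Σ_{x,σ} Re ⟨ψ, c†_{x+e₁,σ} c_{x,σ} ψ⟩| ≤ 2L²` (each term is `Re ⟨c_{x+e₁,σ}ψ, c_{x,σ}ψ⟩`, bounded by
`‖c ψ‖ ‖c ψ‖ ≤ 1` since annihilators are contractions). Bratteli–Robinson II §5.2.2. [folklore] -/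
theorem abs_kineticWeight_le {ψ : Fock (Orb (FermionTorus 2 L))} (hψ : star ψ ⬝ᵥ ψ = 1) :
    |∑ x : Site 2 L, ∑ σ : Fin 2,
        (star ψ ⬝ᵥ ((creation (orb (FermionTorus.ofTorusSite (Site.shift x 0)) σ) *
          annihilation (orb (FermionTorus.ofTorusSite x) σ)) *ᵥ ψ)).re| ≤ 2 * (L : ℝ) ^ 2 := by
  have hψ1 : ‖(WithLp.toLp 2 ψ : EuclideanSpace ℂ (Finset (Orb (FermionTorus 2 L))))‖ = 1 := by
    rw [← pow_eq_one_iff_of_nonneg (norm_nonneg _) two_ne_zero, norm_toLp_sq_eq_re, hψ,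
      Complex.one_re]
  have hterm : ∀ (x : Site 2 L) (σ : Fin 2),
      |(star ψ ⬝ᵥ ((creation (orb (FermionTorus.ofTorusSite (Site.shift x 0)) σ) *
          annihilation (orb (FermionTorus.ofTorusSite x) σ)) *ᵥ ψ)).re| ≤ 1 := by
    intro x σ
    rw [← annihilation_conjTranspose, ← Literature.MathematicalPhysics.QuantumLattice.star_mulVec_dotProduct_mulVec]
    have ha := norm_toLp_annihilation_mulVec_le (orb (FermionTorus.ofTorusSite (Site.shift x 0)) σ) ψ
    have hb := norm_toLp_annihilation_mulVec_le (orb (FermionTorus.ofTorusSite x) σ) ψ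
    rw [hψ1] at ha hb
    rw [abs_le]
    constructor
    · have h := re_star_dotProduct_le_norm_mul_norm
        (-(annihilation (orb (FermionTorus.ofTorusSite (Site.shift x 0)) σ) *ᵥ ψ))
        (annihilation (orb (FermionTorus.ofTorusSite x) σ) *ᵥ ψ)
      rw [star_neg, neg_dotProduct, Complex.neg_re, WithLp.toLp_neg, norm_neg] at h
      nlinarith [norm_nonneg (WithLp.toLp 2 (annihilation (orb (FermionTorus.ofTorusSite x) σ) *ᵥ ψ) :
        EuclideanSpace ℂ (Finset (Orb (FermionTorus 2 L)))),
        norm_nonneg (WithLp.toLp 2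
          (annihilation (orb (FermionTorus.ofTorusSite (Site.shift x 0)) σ) *ᵥ ψ) :
            EuclideanSpace ℂ (Finset (Orb (FermionTorus 2 L))))]
    · have h := re_star_dotProduct_le_norm_mul_norm
        (annihilation (orb (FermionTorus.ofTorusSite (Site.shift x 0)) σ) *ᵥ ψ)
        (annihilation (orb (FermionTorus.ofTorusSite x) σ) *ᵥ ψ)
      nlinarith [norm_nonneg (WithLp.toLp 2 (annihilation (orb (FermionTorus.ofTorusSite x) σ) *ᵥ ψ) :
        EuclideanSpace ℂ (Finset (Orb (FermionTorus 2 L)))),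
        norm_nonneg (WithLp.toLp 2
          (annihilation (orb (FermionTorus.ofTorusSite (Site.shift x 0)) σ) *ᵥ ψ) :
            EuclideanSpace ℂ (Finset (Orb (FermionTorus 2 L))))]
  have hcard : (Finset.univ : Finset (Site 2 L)).card = L ^ 2 := by
    rw [Finset.card_univ]; simp [ZMod.card]
  refine (Finset.abs_sum_le_sum_abs _ _).trans ?_
  calc ∑ x : Site 2 L, |∑ σ : Fin 2,
        (star ψ ⬝ᵥ ((creation (orb (FermionTorus.ofTorusSite (Site.shift x 0)) σ) *
          annihilation (orb (FermionTorus.ofTorusSite x) σ)) *ᵥ ψ)).re|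
      ≤ ∑ _x : Site 2 L, (2 : ℝ) := Finset.sum_le_sum fun x _ => by
          refine (Finset.abs_sum_le_sum_abs _ _).trans ?_
          rw [Fin.sum_univ_two]
          linarith [hterm x 0, hterm x 1]
    _ = 2 * (L : ℝ) ^ 2 := by
          rw [Finset.sum_const, hcard, nsmul_eq_mul]
          push_cast
          ring

/-- The sine terms cancel over a symmetric range of windings: `Σ_{|j| ≤ J} sin(2πj/L) = 0`. [folklore] -/
theorem sum_Icc_sin_eq_zero (J : ℕ) (c : ℝ) :
    ∑ j ∈ Finset.Icc (-(J : ℤ)) J, Real.sin (j * c) = 0 := by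
  have h : ∑ j ∈ Finset.Icc (-(J : ℤ)) J, Real.sin (j * c) =
      ∑ j ∈ Finset.Icc (-(J : ℤ)) J, Real.sin ((-j : ℤ) * c) := by
    refine Finset.sum_nbij' (fun j => -j) (fun j => -j) ?_ ?_ ?_ ?_ ?_
    · intro j hj
      rw [Finset.mem_Icc] at hj ⊢
      omega
    · intro j hj
      rw [Finset.mem_Icc] at hj ⊢
      omega
    · intro j _; simp
    · intro j _; simp
    · intro j _; simp
  have h2 : ∑ j ∈ Finset.Icc (-(J : ℤ)) J, Real.sin ((-j : ℤ) * c) =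
      -∑ j ∈ Finset.Icc (-(J : ℤ)) J, Real.sin (j * c) := by
    rw [← Finset.sum_neg_distrib]
    refine Finset.sum_congr rfl fun j _ => ?_
    rw [Int.cast_neg, neg_mul, Real.sin_neg]
  linarith

omit [NeZero L] in
/-- `Σ_{|j| ≤ J} (1 − cos(2πj/L)) ≤ 2π² J² (2J+1) / L²` (`1 − cos x ≤ x²/2`, `j² ≤ J²`). [folklore] -/
theorem sum_Icc_one_sub_cos_le (J : ℕ) (hL : (0 : ℝ) < L) :
    ∑ j ∈ Finset.Icc (-(J : ℤ)) J, (1 - Real.cos (j * (2 * Real.pi) / L)) ≤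
      2 * Real.pi ^ 2 * (J : ℝ) ^ 2 * (2 * J + 1) / (L : ℝ) ^ 2 := by
  have hterm : ∀ j ∈ Finset.Icc (-(J : ℤ)) J,
      1 - Real.cos (j * (2 * Real.pi) / L) ≤ 2 * Real.pi ^ 2 * (J : ℝ) ^ 2 / (L : ℝ) ^ 2 := by
    intro j hj
    have hjJ := Finset.mem_Icc.1 hj
    have hcos := Real.one_sub_sq_div_two_le_cos (x := j * (2 * Real.pi) / L)
    have hj2 : ((j : ℤ) : ℝ) ^ 2 ≤ (J : ℝ) ^ 2 := by
      have habs : |((j : ℤ) : ℝ)| ≤ (J : ℝ) := by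
        rw [abs_le]
        constructor <;> exact_mod_cast (by omega)
      calc ((j : ℤ) : ℝ) ^ 2 = |((j : ℤ) : ℝ)| ^ 2 := (sq_abs _).symm
        _ ≤ (J : ℝ) ^ 2 := pow_le_pow_left₀ (abs_nonneg _) habs 2
    calc 1 - Real.cos (j * (2 * Real.pi) / L) ≤ (j * (2 * Real.pi) / L) ^ 2 / 2 := by linarith
      _ = 2 * Real.pi ^ 2 * ((j : ℤ) : ℝ) ^ 2 / (L : ℝ) ^ 2 := by
          field_simp
      _ ≤ 2 * Real.pi ^ 2 * (J : ℝ) ^ 2 / (L : ℝ) ^ 2 := by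
          gcongr
  refine (Finset.sum_le_sum hterm).trans ?_
  rw [Finset.sum_const, Int.card_Icc, nsmul_eq_mul]
  have hc : (((J : ℤ) + 1 - -(J : ℤ)).toNat : ℝ) = 2 * J + 1 := by
    have : ((J : ℤ) + 1 - -(J : ℤ)).toNat = 2 * J + 1 := by omega
    rw [this]
    push_cast
    ring
  rw [hc]
  have : 0 ≤ 2 * Real.pi ^ 2 * (J : ℝ) ^ 2 / (L : ℝ) ^ 2 := by positivity
  calc (2 * (J : ℝ) + 1) * (2 * Real.pi ^ 2 * (J : ℝ) ^ 2 / (L : ℝ) ^ 2)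
      = 2 * Real.pi ^ 2 * (J : ℝ) ^ 2 * (2 * J + 1) / (L : ℝ) ^ 2 := by ring
    _ ≤ _ := le_rfl

/-! ### The ceiling -/
/-- **The twist ceiling for the Kac-window excess** (`L ≥ 3`). For the Hubbard torus
`H = hubbardTorus 2 L 1 U`, a form factor with `|f| ≤ 1`, `ε ≥ 0`, `λ ≥ 0`, any `J` with `4J < L`
and any sector `K = szSector N M` containing a unit vector `ψ` with `Re ⟨ψ, H ψ⟩ = minEnergyOn H K`:
`minEnergyOn (H + λW_ε) K − minEnergyOn H K ≤ 8π²J² + 50λ(2⌊εL/2π⌋ + 1)L²/(2J + 1)`.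
Average the `2J + 1` twist pricings (`twistPricing_minEnergyOn_add_smul_sub`): the sine terms
cancel (`sum_Icc_sin_eq_zero`), the cosine costs total `≤ 2|K₁| · 2π²J²(2J+1)/L² ≤ 8π²J²(2J+1)`
(`abs_kineticWeight_le`, `sum_Icc_one_sub_cos_le`), the twisted window weights total
`≤ 50(2⌊εL/2π⌋+1)L²` (`sum_twistedWindowWeight_le`). With `J ≍ L(λε)^{1/3}` the bound is
`≈ 32(λε)^{2/3} L²` (`J ≈ 0.37 L (λε)^{1/3}`). Watanabe (2019) §2.2.1; Kennedy–Lieb–Shastry (1988). [folklore] -/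
theorem windowGap_twistCeiling (hL : 3 ≤ L) (U : ℝ) (N : ℕ) (M : ℝ) (f : Site 2 → ℝ)
    (hf : ∀ e, |f e| ≤ 1) {ε lam : ℝ} (hε : 0 ≤ ε) (hlam : 0 ≤ lam) {J : ℕ} (hJ : 4 * J < L)
    {ψ : Fock (Orb (FermionTorus 2 L))} (hψK : ψ ∈ szSector N M) (hψ : star ψ ⬝ᵥ ψ = 1)
    (hE : (star ψ ⬝ᵥ (hubbardTorus 2 L 1 U *ᵥ ψ)).re = (hubbardTorus 2 L 1 U).minEnergyOn (szSector N M)) :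
    (hubbardTorus 2 L 1 U + (lam : ℂ) • (∑ m : Fin 2 → ZMod L,
        if (2 * Real.pi / (L : ℝ)) ^ 2 * (∑ i : Fin 2, (((m i).valMinAbs : ℤ) : ℝ) ^ 2) ≤ ε ^ 2 then
          ((L : ℂ) ^ 2)⁻¹ • (Matrix.conjTranspose (pairFieldAt f L m) * pairFieldAt f L m)
        else 0)).minEnergyOn (szSector N M) -
        (hubbardTorus 2 L 1 U).minEnergyOn (szSector N M) ≤
      8 * Real.pi ^ 2 * (J : ℝ) ^ 2 +
        50 * lam * (2 * ⌊ε * L / (2 * Real.pi)⌋₊ + 1 : ℕ) * (L : ℝ) ^ 2 / (2 * J + 1) := by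
  have hLpos : (0 : ℝ) < L := Nat.cast_pos.2 (Nat.pos_of_ne_zero (NeZero.ne L))
  set W := (∑ m : Fin 2 → ZMod L,
        if (2 * Real.pi / (L : ℝ)) ^ 2 * (∑ i : Fin 2, (((m i).valMinAbs : ℤ) : ℝ) ^ 2) ≤ ε ^ 2 then
          ((L : ℂ) ^ 2)⁻¹ • (Matrix.conjTranspose (pairFieldAt f L m) * pairFieldAt f L m)
        else 0) with hW
  set gap := (hubbardTorus 2 L 1 U + (lam : ℂ) • W).minEnergyOn (szSector N M) -
        (hubbardTorus 2 L 1 U).minEnergyOn (szSector N M) with hgap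
  set K₁ := ∑ x : Site 2 L, ∑ σ : Fin 2,
        (star ψ ⬝ᵥ ((creation (orb (FermionTorus.ofTorusSite (Site.shift x 0)) σ) *
          annihilation (orb (FermionTorus.ofTorusSite x) σ)) *ᵥ ψ)).re with hK₁
  set J₁ := ∑ x : Site 2 L, ∑ σ : Fin 2,
        (star ψ ⬝ᵥ ((creation (orb (FermionTorus.ofTorusSite (Site.shift x 0)) σ) *
          annihilation (orb (FermionTorus.ofTorusSite x) σ)) *ᵥ ψ)).im with hJ₁
  -- the `2J + 1` pricings
  have hprice : ∀ j ∈ Finset.Icc (-(J : ℤ)) J, gap ≤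
      2 * (1 - Real.cos (j * (2 * Real.pi) / L)) * K₁ + 2 * Real.sin (j * (2 * Real.pi) / L) * J₁ +
        lam * (star (phaseGauge (fun u : FermionTorus 2 L =>
            twistGauge L (j * (2 * Real.pi)) u.toTorusSite) *ᵥ ψ) ⬝ᵥ
          (W *ᵥ (phaseGauge (fun u : FermionTorus 2 L =>
            twistGauge L (j * (2 * Real.pi)) u.toTorusSite) *ᵥ ψ))).re :=
    fun j _ => twistPricing_minEnergyOn_add_smul_sub hL U N M W lam j hψK hψ hE
  have hsum := Finset.sum_le_sum hprice
  rw [Finset.sum_const, Int.card_Icc, nsmul_eq_mul] at hsum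
  have hcardR : (((J : ℤ) + 1 - -(J : ℤ)).toNat : ℝ) = 2 * J + 1 := by
    have : ((J : ℤ) + 1 - -(J : ℤ)).toNat = 2 * J + 1 := by omega
    rw [this]; push_cast; ring
  rw [hcardR, Finset.sum_add_distrib, Finset.sum_add_distrib] at hsum
  -- the three sums
  have hcos : ∑ j ∈ Finset.Icc (-(J : ℤ)) J, 2 * (1 - Real.cos (j * (2 * Real.pi) / L)) * K₁ ≤
      8 * Real.pi ^ 2 * (J : ℝ) ^ 2 * (2 * J + 1) := by
    have h1 : ∑ j ∈ Finset.Icc (-(J : ℤ)) J, 2 * (1 - Real.cos (j * (2 * Real.pi) / L)) * K₁ =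
        2 * K₁ * ∑ j ∈ Finset.Icc (-(J : ℤ)) J, (1 - Real.cos (j * (2 * Real.pi) / L)) := by
      rw [Finset.mul_sum]
      refine Finset.sum_congr rfl fun j _ => ?_
      ring
    rw [h1]
    have hS0 : 0 ≤ ∑ j ∈ Finset.Icc (-(J : ℤ)) J, (1 - Real.cos (j * (2 * Real.pi) / L)) :=
      Finset.sum_nonneg fun j _ => by linarith [Real.cos_le_one (j * (2 * Real.pi) / L)]
    have hS := sum_Icc_one_sub_cos_le (L := L) J hLpos
    have hK := abs_kineticWeight_le (L := L) hψ
    have hKle : 2 * K₁ ≤ 2 * (2 * (L : ℝ) ^ 2) := by linarith [(abs_le.1 hK).2]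
    calc 2 * K₁ * ∑ j ∈ Finset.Icc (-(J : ℤ)) J, (1 - Real.cos (j * (2 * Real.pi) / L))
        ≤ 2 * (2 * (L : ℝ) ^ 2) * ∑ j ∈ Finset.Icc (-(J : ℤ)) J, (1 - Real.cos (j * (2 * Real.pi) / L)) :=
          mul_le_mul_of_nonneg_right hKle hS0
      _ ≤ 2 * (2 * (L : ℝ) ^ 2) * (2 * Real.pi ^ 2 * (J : ℝ) ^ 2 * (2 * J + 1) / (L : ℝ) ^ 2) :=
          mul_le_mul_of_nonneg_left hS (by positivity)
      _ = 8 * Real.pi ^ 2 * (J : ℝ) ^ 2 * (2 * J + 1) := by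
          field_simp
          ring
  have hsin : ∑ j ∈ Finset.Icc (-(J : ℤ)) J, 2 * Real.sin (j * (2 * Real.pi) / L) * J₁ = 0 := by
    have h1 : ∑ j ∈ Finset.Icc (-(J : ℤ)) J, 2 * Real.sin (j * (2 * Real.pi) / L) * J₁ =
        2 * J₁ * ∑ j ∈ Finset.Icc (-(J : ℤ)) J, Real.sin (j * (2 * Real.pi / L)) := by
      rw [Finset.mul_sum]
      refine Finset.sum_congr rfl fun j _ => ?_
      rw [mul_div_assoc]
      ring
    rw [h1, sum_Icc_sin_eq_zero, mul_zero]
  have hwin : ∑ j ∈ Finset.Icc (-(J : ℤ)) J,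
      lam * (star (phaseGauge (fun u : FermionTorus 2 L =>
            twistGauge L (j * (2 * Real.pi)) u.toTorusSite) *ᵥ ψ) ⬝ᵥ
          (W *ᵥ (phaseGauge (fun u : FermionTorus 2 L =>
            twistGauge L (j * (2 * Real.pi)) u.toTorusSite) *ᵥ ψ))).re ≤
      lam * (50 * (2 * ⌊ε * L / (2 * Real.pi)⌋₊ + 1 : ℕ) * (L : ℝ) ^ 2) := by
    rw [← Finset.mul_sum]
    exact mul_le_mul_of_nonneg_left (sum_twistedWindowWeight_le f hf hε hJ hψ) hlam
  -- divide by `2J + 1`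
  have hJpos : (0 : ℝ) < 2 * J + 1 := by positivity
  have htot : (2 * (J : ℝ) + 1) * gap ≤
      8 * Real.pi ^ 2 * (J : ℝ) ^ 2 * (2 * J + 1) + lam * (50 * (2 * ⌊ε * L / (2 * Real.pi)⌋₊ + 1 : ℕ) *
        (L : ℝ) ^ 2) := by linarith
  have heq : 8 * Real.pi ^ 2 * (J : ℝ) ^ 2 +
        50 * lam * (2 * ⌊ε * L / (2 * Real.pi)⌋₊ + 1 : ℕ) * (L : ℝ) ^ 2 / (2 * J + 1) =
      (8 * Real.pi ^ 2 * (J : ℝ) ^ 2 * (2 * J + 1) +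
        lam * (50 * (2 * ⌊ε * L / (2 * Real.pi)⌋₊ + 1 : ℕ) * (L : ℝ) ^ 2)) / (2 * J + 1) := by
    field_simp
  rw [heq, le_div_iff₀ hJpos]
  linarith

/-! ### The `(λ, a)`-uniform strengthening of the crux is false -/
/-- **The penalty strength and the order constant cannot be chosen before the window radius.**
The strengthening of `WindowGap` in which `λ > 0` and `a > 0` are fixed BEFORE `∀ ε₀ ∃ ε ≤ ε₀`
(already with tail allowance `C = 0`) is false at every `U`, `δ`: by `windowGap_twistCeiling` with
`J = ⌊γL⌋`, `γ = min (1/8) (√(λa)/(8π))`, `|d| ≤ 1`, at a sector ground state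
(`exists_unit_groundStateInSector_hubbardTorus`), the excess at `ε ≤ πγa/200` and large even `L` is
`≤ (1/8 + 1/2)λaL² < λaL²`. So the crux's witnesses `(λ, a)` must depend on `ε` (physically
`λ ≍ ρ_s ε²/m²`). Watanabe (2019) §2.2.1; Tasaki (2020) §2.1. [folklore] -/
theorem not_windowGap_uniform :
    ¬ ∃ U : ℝ, 0 < U ∧ ∃ δ ∈ Set.Ioo (0:ℝ) (1 / 2), ∃ lam a : ℝ, 0 < lam ∧ 0 < a ∧
      ∀ ε₀ : ℝ, 0 < ε₀ → ∃ ε ∈ Set.Ioc (0:ℝ) ε₀, ∃ L₀ : ℕ, ∀ (L : ℕ) [NeZero L], L₀ ≤ L → Even L →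
        lam * a * (L : ℝ) ^ 2 ≤
          (hubbardTorus 2 L 1 U + (lam : ℂ) • (∑ m : Fin 2 → ZMod L,
              if (2 * Real.pi / (L : ℝ)) ^ 2 * (∑ i : Fin 2, (((m i).valMinAbs : ℤ) : ℝ) ^ 2) ≤ ε ^ 2
              then ((L : ℂ) ^ 2)⁻¹ • (Matrix.conjTranspose (pairFieldAt dWaveFormFactor L m) *
                pairFieldAt dWaveFormFactor L m)
              else 0)).minEnergyOn (szSector (2 * ⌊(1 - δ) * (L : ℝ) ^ 2 / 2⌋₊) 0) -
            (hubbardTorus 2 L 1 U).minEnergyOn (szSector (2 * ⌊(1 - δ) * (L : ℝ) ^ 2 / 2⌋₊) 0) := by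
  rintro ⟨U, _hU, δ, hδ, lam, a, hlam, ha, h⟩
  -- the slope `γ` of `J = ⌊γL⌋`
  obtain ⟨γ, hγdef⟩ : ∃ γ : ℝ, γ = min (1 / 8) (Real.sqrt (lam * a) / (8 * Real.pi)) := ⟨_, rfl⟩
  have hla : 0 < lam * a := mul_pos hlam ha
  have hγpos : 0 < γ := by
    rw [hγdef]
    exact lt_min (by norm_num) (div_pos (Real.sqrt_pos.2 hla) (by positivity))
  have hγ8 : γ ≤ 1 / 8 := hγdef ▸ min_le_left _ _
  have hγsq : γ ^ 2 ≤ lam * a / (64 * Real.pi ^ 2) := by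
    have h1 : γ ≤ Real.sqrt (lam * a) / (8 * Real.pi) := hγdef ▸ min_le_right _ _
    have h2 : γ ^ 2 ≤ (Real.sqrt (lam * a) / (8 * Real.pi)) ^ 2 := pow_le_pow_left₀ hγpos.le h1 2
    rw [div_pow, Real.sq_sqrt hla.le] at h2
    calc γ ^ 2 ≤ lam * a / (8 * Real.pi) ^ 2 := h2
      _ = lam * a / (64 * Real.pi ^ 2) := by ring
  -- the window radius
  obtain ⟨ε, hε, L₀, hL₀⟩ := h (Real.pi * γ * a / 200) (by positivity)
  have hεpos : 0 < ε := hε.1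
  -- a large even side `L = 2K`
  obtain ⟨K, hKdef⟩ : ∃ K : ℕ, K = max L₀ (⌈200 / (γ * a)⌉₊ + ⌈1 / γ⌉₊ + 2) := ⟨_, rfl⟩
  have hK₀ : L₀ ≤ 2 * K := by
    rw [hKdef]
    exact (le_max_left _ _).trans (Nat.le_mul_of_pos_left _ two_pos)
  have hK2 : ⌈200 / (γ * a)⌉₊ + ⌈1 / γ⌉₊ + 2 ≤ K := hKdef ▸ le_max_right _ _
  haveI : NeZero (2 * K) := ⟨by omega⟩
  have hgap := hL₀ (2 * K) hK₀ (even_two_mul K)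
  have hLge3 : 3 ≤ 2 * K := by omega
  have hLreal : ((2 * K : ℕ) : ℝ) = 2 * (K : ℝ) := by push_cast; ring
  have hKreal : (⌈200 / (γ * a)⌉₊ : ℝ) + ⌈1 / γ⌉₊ + 2 ≤ K := by exact_mod_cast hK2
  have hceil1 : 200 / (γ * a) ≤ (⌈200 / (γ * a)⌉₊ : ℝ) := Nat.le_ceil _
  have hceil2 : 1 / γ ≤ (⌈1 / γ⌉₊ : ℝ) := Nat.le_ceil _
  have hLpos : (0 : ℝ) < ((2 * K : ℕ) : ℝ) := by
    rw [hLreal]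
    linarith [hKreal, Nat.cast_nonneg (α := ℝ) ⌈200 / (γ * a)⌉₊, Nat.cast_nonneg (α := ℝ) ⌈1 / γ⌉₊]
  have hγL1 : 1 ≤ γ * ((2 * K : ℕ) : ℝ) := by
    rw [hLreal]
    have h1 : 1 / γ ≤ (K : ℝ) := by linarith [Nat.cast_nonneg (α := ℝ) (⌈200 / (γ * a)⌉₊)]
    rw [div_le_iff₀ hγpos] at h1
    nlinarith
  have hγLa : 200 ≤ γ * a * ((2 * K : ℕ) : ℝ) := by
    rw [hLreal]
    have h1 : 200 / (γ * a) ≤ (K : ℝ) := by linarith [Nat.cast_nonneg (α := ℝ) (⌈1 / γ⌉₊)]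
    rw [div_le_iff₀ (mul_pos hγpos ha)] at h1
    nlinarith [mul_pos hγpos ha]
  -- the winding range `J = ⌊γ L⌋`
  obtain ⟨J, hJdef⟩ : ∃ J : ℕ, J = ⌊γ * ((2 * K : ℕ) : ℝ)⌋₊ := ⟨_, rfl⟩
  have hJle : (J : ℝ) ≤ γ * ((2 * K : ℕ) : ℝ) := hJdef ▸ Nat.floor_le (by positivity)
  have hJge : γ * ((2 * K : ℕ) : ℝ) - 1 ≤ J := by
    have := Nat.lt_floor_add_one (γ * ((2 * K : ℕ) : ℝ))
    rw [← hJdef] at this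
    linarith
  have h4J : 4 * J < 2 * K := by
    have h1 : (4 * J : ℝ) ≤ 4 * (γ * ((2 * K : ℕ) : ℝ)) := by linarith
    have h2 : 4 * (γ * ((2 * K : ℕ) : ℝ)) ≤ ((2 * K : ℕ) : ℝ) / 2 := by nlinarith
    have h3 : ((2 * K : ℕ) : ℝ) / 2 < ((2 * K : ℕ) : ℝ) := by linarith
    have h4 : (4 * J : ℝ) < ((2 * K : ℕ) : ℝ) := by linarith
    exact_mod_cast h4
  -- a sector ground state at the side `2K`
  obtain ⟨ψ, hψ1, hgs⟩ :=
    Summit.HubbardSuperconductivity.NoGo.exists_unit_groundStateInSector_hubbardTorus (2 * K) 1 U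
      (Summit.HubbardSuperconductivity.NoGo.floor_pairNumber_le δ (by linarith [hδ.1]) (2 * K))
  have hE : (star ψ ⬝ᵥ (hubbardTorus 2 (2 * K) 1 U *ᵥ ψ)).re =
      (hubbardTorus 2 (2 * K) 1 U).minEnergyOn
        (szSector (2 * ⌊(1 - δ) * ((2 * K : ℕ) : ℝ) ^ 2 / 2⌋₊) 0) := by
    rw [hgs.2.2, dotProduct_smul, hψ1, smul_eq_mul, mul_one, Complex.ofReal_re]
  have hdw : ∀ e : Site 2, |dWaveFormFactor e| ≤ 1 := fun e => by
    unfold dWaveFormFactor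
    split_ifs <;> norm_num
  have hceiling := windowGap_twistCeiling hLge3 U _ 0 dWaveFormFactor hdw
    hεpos.le hlam.le h4J hgs.1 hψ1 hE (ε := ε)
  -- the ceiling is below `λ a L²`: the kinetic part
  have hkin : 8 * Real.pi ^ 2 * (J : ℝ) ^ 2 ≤ lam * a * ((2 * K : ℕ) : ℝ) ^ 2 / 8 := by
    have h1 : (J : ℝ) ^ 2 ≤ (γ * ((2 * K : ℕ) : ℝ)) ^ 2 := pow_le_pow_left₀ (Nat.cast_nonneg _) hJle 2
    have h3 : 8 * Real.pi ^ 2 * γ ^ 2 ≤ lam * a / 8 := by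
      calc 8 * Real.pi ^ 2 * γ ^ 2 ≤ 8 * Real.pi ^ 2 * (lam * a / (64 * Real.pi ^ 2)) :=
            mul_le_mul_of_nonneg_left hγsq (by positivity)
        _ = lam * a / 8 := by
            field_simp
            ring
    have h4 : 0 ≤ ((2 * K : ℕ) : ℝ) ^ 2 := sq_nonneg _
    calc 8 * Real.pi ^ 2 * (J : ℝ) ^ 2 ≤ 8 * Real.pi ^ 2 * (γ * ((2 * K : ℕ) : ℝ)) ^ 2 :=
          mul_le_mul_of_nonneg_left h1 (by positivity)
      _ = (8 * Real.pi ^ 2 * γ ^ 2) * ((2 * K : ℕ) : ℝ) ^ 2 := by ring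
      _ ≤ (lam * a / 8) * ((2 * K : ℕ) : ℝ) ^ 2 := mul_le_mul_of_nonneg_right h3 h4
      _ = lam * a * ((2 * K : ℕ) : ℝ) ^ 2 / 8 := by ring
  -- the ceiling is below `λ a L²`: the window part
  have hR : ((2 * ⌊ε * ((2 * K : ℕ) : ℝ) / (2 * Real.pi)⌋₊ + 1 : ℕ) : ℝ) ≤
      ε * ((2 * K : ℕ) : ℝ) / Real.pi + 1 := by
    have hfl : (⌊ε * ((2 * K : ℕ) : ℝ) / (2 * Real.pi)⌋₊ : ℝ) ≤ ε * ((2 * K : ℕ) : ℝ) / (2 * Real.pi) :=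
      Nat.floor_le (by positivity)
    have heq : 2 * (ε * ((2 * K : ℕ) : ℝ) / (2 * Real.pi)) = ε * ((2 * K : ℕ) : ℝ) / Real.pi := by
      field_simp
    rw [hLreal] at hfl heq ⊢
    push_cast
    linarith
  have hwt : 50 * lam * ((2 * ⌊ε * ((2 * K : ℕ) : ℝ) / (2 * Real.pi)⌋₊ + 1 : ℕ) : ℝ) *
        ((2 * K : ℕ) : ℝ) ^ 2 / (2 * J + 1) ≤ lam * a * ((2 * K : ℕ) : ℝ) ^ 2 / 2 := by
    have hden : γ * ((2 * K : ℕ) : ℝ) ≤ 2 * (J : ℝ) + 1 := by linarith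
    have hdenpos : 0 < γ * ((2 * K : ℕ) : ℝ) := by positivity
    have hJpos : (0 : ℝ) < 2 * J + 1 := by positivity
    -- numerator: `(2R+1) ≤ εL/π + 1 ≤ (a γ L)/100`, using `ε ≤ πγa/200` and `200 ≤ γ a L`
    have hεa : ε * ((2 * K : ℕ) : ℝ) / Real.pi ≤ γ * a * ((2 * K : ℕ) : ℝ) / 200 := by
      rw [div_le_div_iff₀ Real.pi_pos (by norm_num)]
      have h1 : ε ≤ Real.pi * γ * a / 200 := hε.2
      have h2 : ε * 200 ≤ Real.pi * γ * a := by
        rw [le_div_iff₀ (by norm_num)] at h1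
        linarith
      nlinarith [hLpos.le]
    have hnum : ((2 * ⌊ε * ((2 * K : ℕ) : ℝ) / (2 * Real.pi)⌋₊ + 1 : ℕ) : ℝ) ≤
        γ * a * ((2 * K : ℕ) : ℝ) / 100 := by linarith
    have hstep1 : 50 * lam * ((2 * ⌊ε * ((2 * K : ℕ) : ℝ) / (2 * Real.pi)⌋₊ + 1 : ℕ) : ℝ) *
          ((2 * K : ℕ) : ℝ) ^ 2 ≤
        50 * lam * (γ * a * ((2 * K : ℕ) : ℝ) / 100) * ((2 * K : ℕ) : ℝ) ^ 2 := by
      have : 0 ≤ 50 * lam := by positivity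
      have : 0 ≤ ((2 * K : ℕ) : ℝ) ^ 2 := sq_nonneg _
      gcongr
    have hstep2 : 50 * lam * (γ * a * ((2 * K : ℕ) : ℝ) / 100) * ((2 * K : ℕ) : ℝ) ^ 2 / (2 * J + 1) ≤
        50 * lam * (γ * a * ((2 * K : ℕ) : ℝ) / 100) * ((2 * K : ℕ) : ℝ) ^ 2 / (γ * ((2 * K : ℕ) : ℝ)) :=
      div_le_div_of_nonneg_left (by positivity) hdenpos hden
    have hstep3 : 50 * lam * (γ * a * ((2 * K : ℕ) : ℝ) / 100) * ((2 * K : ℕ) : ℝ) ^ 2 /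
          (γ * ((2 * K : ℕ) : ℝ)) = lam * a * ((2 * K : ℕ) : ℝ) ^ 2 / 2 := by
      field_simp
      ring
    calc _ ≤ 50 * lam * (γ * a * ((2 * K : ℕ) : ℝ) / 100) * ((2 * K : ℕ) : ℝ) ^ 2 / (2 * J + 1) :=
          div_le_div_of_nonneg_right hstep1 hJpos.le
      _ ≤ _ := hstep2
      _ = _ := hstep3
  have hL2pos : 0 < lam * a * ((2 * K : ℕ) : ℝ) ^ 2 := by positivity
  linarith

end Summit.HubbardSuperconductivity.HubbardSuperconductivity.Theorems.WindowGap.Negative
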